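import Summits.AtomisticToContinuum.HydrodynamicLimit.Theorems.OneFlightGossipEngineEnergyCurrentTailsSplit
import Summits.AtomisticToContinuum.HydrodynamicLimit.Theorems.OneFlightGossipEngineEnergyCurrentTailsLossFloorGlue4
import Summits.AtomisticToContinuum.HydrodynamicLimit.Theorems.OneFlightGossipEngineEnergyCurrentTailsLossIntensityFloor4MixingGlue
import HarnessLib

/-!
# Crux `EnergyCurrentTails` (stmt-AtomisticToContinuum-9235), line `quartic-schur-ledger`:
# the composition from the THERMAL-RATE mixing floor QMF₄ (seat c5 cycle-3 reshape)

Companion of `…EnergyCurrentTailsSplit.lean`.  The absorbing one-window recursion needs a destruction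
floor proportional to the quartic CONTENT per kinetic window, i.e. a mixing-collision rate `∝ ν_N` per
lab-fast sphere — not the sweeping rate `∝ ν_N‖v‖` of QMF/RF₂.  With the fourth-moment loss-intensity
floor LIF₄ (`δν∫M₄^{>K₀} ≤ Loss + Cν(s′−s) sup m₂ sup m₃`, from QMF₄ and S2a″ by the landed LIF₄″
`stub_lossIntensityFloor4_of_mixingFlux4`), the K₀-free window floor WF₄ (`stub_windowQuarticFloor4`) and
the re-run S1-glue₄ (`stub_lossFloor_of_lossIntensityFloor4`, `κ₀ = δσ²`), the quartic maximum principle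
closes exactly as before:

* `EnergyCurrentTails_of_lossIntensityFloor4 : LIF₄ → S2a″ → EnergyCurrentTails`;
* `EnergyCurrentTails_of_mixingFloor4 : QMF₄ → S2a″ → EnergyCurrentTails` — the crux is CLOSED MODULO
  {QMF₄ `stub_quarticMixingFloor4`, S2a″ `stub_energyFluxCeilingWindows`}, QMF₄ being the weakest lower
  primitive the line can consume (thermal-rate, one rare participant, ‖v‖⁴-weighted, time-integrated) and
  S2a″ having the typed producer stmt-AtomisticToContinuum-16939.
-/

noncomputable section

open MeasureTheory Set Filter
open scoped ENNReal

namespace Summit.AtomisticToContinuum.HydrodynamicLimit.Theorems.QuarticSchurLedger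

open Literature.MathematicalPhysics.KineticTheory Literature.Analysis.FluidPDE

/-- **The quartic maximum principle from the FOURTH-moment loss-intensity floor: LIF₄ → S2a″ →
`EnergyCurrentTails`** (line `quartic-schur-ledger`, crux stmt-AtomisticToContinuum-9235; seat c5 cycle 3).
As `EnergyCurrentTails_of_lossIntensityFloor`, with S1 := S1-glue₄(S2, LIF₄)
(`stub_lossFloor_of_lossIntensityFloor4`, which uses the landed Q0 `stub_quarticData` and WF₄ `stub_windowQuarticFloor4`). [folklore] -/
theorem EnergyCurrentTails_of_lossIntensityFloor4 :
    (∀ (a₀ θ₀ : T3 → ℝ) (u₀ : T3 → V3), Continuous a₀ → Continuous θ₀ → Continuous u₀ → (∀ x, 0 < a₀ x) →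
    (∀ x, 0 < θ₀ x) → ∃ σ₀ : ℝ, 0 < σ₀ ∧ ∀ σ, 0 < σ → σ < σ₀ → ∀ T, 0 < T → ∀ Φ : (N : ℕ) → HardSphereFlow
    (Torus.geometry (Fin 3)) (hsDiameter σ N) (N+1), ∃ δ, 0 < δ ∧ ∃ K₀, 0 ≤ K₀ ∧ ∃ C, 0 ≤ C ∧ ∃ N₀, ∀ N :
    ℕ, N₀ ≤ N → ∀ s s', 0 ≤ s → s ≤ s' → s' ≤ T → ENNReal.ofReal (δ*(σ^2*((N : ℝ)+1)^(1/3 : ℝ)))*(∫⁻ r in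
    Ioc s s', (∫⁻ z, ENNReal.ofReal (((N : ℝ)+1)⁻¹*∑ i, (if K₀ < ‖((Φ N).flow r z i).2‖ then ‖((Φ N).flow
    r z i).2‖^4 else 0)) ∂localGibbsLaw σ a₀ u₀ θ₀ N (Φ N))) ≤ (∫⁻ z, ENNReal.ofReal (((N : ℝ)+1)⁻¹*(Φ
    N).collisionSum (Ioc s s') (fun col => max (‖col.preVel.1‖^4 + ‖col.preVel.2‖^4 - ‖col.postVel.1‖^4 -
    ‖col.postVel.2‖^4) 0 / 2) z) ∂localGibbsLaw σ a₀ u₀ θ₀ N (Φ N)) + ENNReal.ofReal (C*(σ^2*((N :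
    ℝ)+1)^(1/3 : ℝ)*(s' - s)))*(⨆ r ∈ Icc s s', (∫⁻ z, ENNReal.ofReal (((N : ℝ)+1)⁻¹*∑ i, ‖((Φ N).flow r z
    i).2‖^2) ∂localGibbsLaw σ a₀ u₀ θ₀ N (Φ N)))*(⨆ r ∈ Icc s s', (∫⁻ z, ENNReal.ofReal (((N : ℝ)+1)⁻¹*∑
    i, ‖((Φ N).flow r z i).2‖^3) ∂localGibbsLaw σ a₀ u₀ θ₀ N (Φ N)))) → (∀ (a₀ θ₀ : T3 → ℝ) (u₀ : T3 →
    V3), Continuous a₀ → Continuous θ₀ → Continuous u₀ → (∀ x, 0 < a₀ x) → (∀ x, 0 < θ₀ x) → ∃ σ₀ : ℝ, 0 <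
    σ₀ ∧ ∀ σ, 0 < σ → σ < σ₀ → ∀ T, 0 < T → ∀ Φ : (N : ℕ) → HardSphereFlow (Torus.geometry (Fin 3))
    (hsDiameter σ N) (N+1), ∃ C, 0 ≤ C ∧ ∃ N₀, ∀ N : ℕ, N₀ ≤ N → ∀ s s', 0 ≤ s → s ≤ s' → s' ≤ T → (∫⁻ z,
    ENNReal.ofReal (((N : ℝ)+1)⁻¹*(Φ N).collisionSum (Ioc s s') (fun col =>
    ‖col.preVel.1‖^2*‖col.preVel.2‖^2) z) ∂localGibbsLaw σ a₀ u₀ θ₀ N (Φ N)) ≤ ENNReal.ofReal (C*(σ^2*((N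
    : ℝ)+1)^(1/3 : ℝ)*(s' - s)))*(⨆ r ∈ Icc s s', (∫⁻ z, ENNReal.ofReal (((N : ℝ)+1)⁻¹*∑ i, ‖((Φ N).flow r
    z i).2‖^2) ∂localGibbsLaw σ a₀ u₀ θ₀ N (Φ N)))*(⨆ r ∈ Icc s s', (∫⁻ z, ENNReal.ofReal (((N : ℝ)+1)⁻¹*∑
    i, ‖((Φ N).flow r z i).2‖^3) ∂localGibbsLaw σ a₀ u₀ θ₀ N (Φ N)))) →
    Summit.AtomisticToContinuum.HydrodynamicLimit.Theses.OneFlightGossipEngine.EnergyCurrentTails := by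
  intro hLIF hW
  -- the two derived crux-frame stubs S2 (gain ceiling) and S1 (loss floor), from landed glue
  have h2 := stub_gainCeiling_of_energyFluxCeiling stub_quarticData (stub_energyFluxCeiling_of_windows hW)
  have h1 := stub_lossFloor_of_lossIntensityFloor4 h2 hLIF
  refine Summit.AtomisticToContinuum.HydrodynamicLimit.Theorems.LoschmidtTagging.stub_quarticDocking ?_
  -- C⁺: the N-uniform quartic moment along the flow before the first shock
  intro a₀ θ₀ u₀ ha hθ hu ha0 hθ0
  obtain ⟨σ₁, hσ₁, H1⟩ := h1 a₀ θ₀ u₀ ha hθ hu ha0 hθ0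
  obtain ⟨σ₂, hσ₂, H2⟩ := h2 a₀ θ₀ u₀ ha hθ hu ha0 hθ0
  obtain ⟨σ₃, hσ₃, H3⟩ := stub_quarticData a₀ θ₀ u₀ ha hθ hu ha0 hθ0
  refine ⟨min (min σ₁ σ₂) (min σ₃ (1 / 2)),
    lt_min (lt_min hσ₁ hσ₂) (lt_min hσ₃ (by norm_num)), ?_⟩
  intro σ hσ hσlt T ρ θ u hE Φ h0 t ht
  have hσ₁' : σ < σ₁ := lt_of_lt_of_le hσlt ((min_le_left _ _).trans (min_le_left _ _))
  have hσ₂' : σ < σ₂ := lt_of_lt_of_le hσlt ((min_le_left _ _).trans (min_le_right _ _))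
  have hσ₃' : σ < σ₃ := lt_of_lt_of_le hσlt ((min_le_right _ _).trans (min_le_left _ _))
  have hσh : σ < 1 / 2 := lt_of_lt_of_le hσlt ((min_le_right _ _).trans (min_le_right _ _))
  obtain ⟨τ, hτ, c, hc, hc1, A, hA, N₁, HS1⟩ := H1 σ hσ hσ₁' T ρ θ u hE Φ h0 t ht
  obtain ⟨D, hD, N₂, HS2⟩ := H2 σ hσ hσ₂' T ρ θ u hE Φ h0 t ht τ hτ (c / 4) (by positivity)
  obtain ⟨B, hB, N₃, HQ⟩ := H3 σ hσ hσ₃' Φ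
  refine ⟨2 * (max B (2 * A + 4 * D / c) + D), max N₁ (max N₂ N₃), fun N hN s hs => ?_⟩
  have hN₁ : N₁ ≤ N := le_trans (le_max_left _ _) hN
  have hN₂ : N₂ ≤ N := le_trans ((le_max_left _ _).trans (le_max_right _ _)) hN
  have hN₃ : N₃ ≤ N := le_trans ((le_max_right _ _).trans (le_max_right _ _)) hN
  obtain ⟨hQ0, B', hB'⟩ := HQ N hN₃
  have hh : 0 < τ * ((N : ℝ) + 1) ^ (-(1 / 3 : ℝ)) := by positivity
  exact absorbing_recursion
    (y := fun r => ∫⁻ z, ENNReal.ofReal (((N : ℝ) + 1)⁻¹ * ∑ i : Fin (N + 1), ‖((Φ N).flow r z i).2‖ ^ 4)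
      ∂(localGibbsLaw σ a₀ u₀ θ₀ N (Φ N)))
    (G := fun s s' => ∫⁻ z, ENNReal.ofReal (((N : ℝ) + 1)⁻¹ *
      (Φ N).collisionSum (Set.Ioc s s')
        (fun col => max (‖col.postVel.1‖ ^ 4 + ‖col.postVel.2‖ ^ 4
          - ‖col.preVel.1‖ ^ 4 - ‖col.preVel.2‖ ^ 4) 0 / 2) z) ∂(localGibbsLaw σ a₀ u₀ θ₀ N (Φ N)))
    (L := fun s s' => ∫⁻ z, ENNReal.ofReal (((N : ℝ) + 1)⁻¹ *
      (Φ N).collisionSum (Set.Ioc s s')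
        (fun col => max (‖col.preVel.1‖ ^ 4 + ‖col.preVel.2‖ ^ 4
          - ‖col.postVel.1‖ ^ 4 - ‖col.postVel.2‖ ^ 4) 0 / 2) z) ∂(localGibbsLaw σ a₀ u₀ θ₀ N (Φ N)))
    (t := t) hh hc hc1 hA hD (by positivity) le_rfl hB hB' hQ0
    (fun s₁ s₂ hs₁ hs₁₂ => stub_quarticLedger a₀ θ₀ u₀ σ hσ hσh N (Φ N) s₁ s₂ hs₁ hs₁₂)
    (HS1 N hN₁) (HS2 N hN₂) s hs

/-- **The crux from the thermal-rate mixing floor and the flux ceiling: QMF₄ → S2a″ →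
`EnergyCurrentTails`** (seat c5 cycle-3 reshape; QMF₄ = `stub_quarticMixingFloor4`:
`cσ²(N+1)^{1/3}∫_s^t E[(N+1)⁻¹Σ_{‖vᵢ‖>K₀}‖vᵢ‖⁴] ≤ E[Σ_coll Σ_ord 𝟙{‖vᵢ⁻‖>K₀}(N+1)⁻¹·2‖vᵢ⁺‖²‖vⱼ⁺‖²]`).
Proof: the landed LIF₄″ `stub_lossIntensityFloor4_of_mixingFlux4` and
`EnergyCurrentTails_of_lossIntensityFloor4`. [folklore] -/
theorem EnergyCurrentTails_of_mixingFloor4 :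
    (∀ (a₀ θ₀ : T3 → ℝ) (u₀ : T3 → V3), Continuous a₀ → Continuous θ₀ → Continuous u₀ → (∀ x, 0 < a₀ x) →
    (∀ x, 0 < θ₀ x) → ∃ σ₀ : ℝ, 0 < σ₀ ∧ ∀ σ, 0 < σ → σ < σ₀ → ∀ T, 0 < T → ∀ Φ : (N : ℕ) → HardSphereFlow
    (Torus.geometry (Fin 3)) (hsDiameter σ N) (N+1), ∃ K₀, 0 ≤ K₀ ∧ ∃ c, 0 < c ∧ ∃ N₀, ∀ N, N₀ ≤ N → ∀ s
    t, 0 ≤ s → s ≤ t → t ≤ T → ENNReal.ofReal (c*(σ^2*((N+1 : ℕ) : ℝ)^((1 : ℝ)/3)))*∫⁻ τ in Ioc s t, (∫⁻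
    z, ENNReal.ofReal (((N+1 : ℕ) : ℝ)⁻¹*∑ i, if K₀ < ‖((Φ N).flow τ z i).2‖ then ‖((Φ N).flow τ z i).2‖^4
    else 0) ∂localGibbsLaw σ a₀ u₀ θ₀ N (Φ N)) ≤ ∫⁻ z, (∑ᶠ τ ∈ collisionTimes (Torus.geometry (Fin 3))
    (hsDiameter σ N) ((Φ N).flow · z) ∩ Ioc s t, ∑ i, ∑ j, if i = j then 0 else (contactSet
    (Torus.geometry (Fin 3)) _ (hsDiameter σ N) i j).indicator (fun y => if K₀ < ‖(collidePair
    (Torus.geometry (Fin 3)) i j y i).2‖ then ENNReal.ofReal (((N+1 : ℕ) : ℝ)⁻¹*(2*(‖(y i).2‖^2*‖(y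
    j).2‖^2))) else 0) ((Φ N).flow τ z)) ∂localGibbsLaw σ a₀ u₀ θ₀ N (Φ N)) → (∀ (a₀ θ₀ : T3 → ℝ) (u₀ : T3
    → V3), Continuous a₀ → Continuous θ₀ → Continuous u₀ → (∀ x, 0 < a₀ x) → (∀ x, 0 < θ₀ x) → ∃ σ₀ : ℝ, 0
    < σ₀ ∧ ∀ σ, 0 < σ → σ < σ₀ → ∀ T, 0 < T → ∀ Φ : (N : ℕ) → HardSphereFlow (Torus.geometry (Fin 3))
    (hsDiameter σ N) (N+1), ∃ C, 0 ≤ C ∧ ∃ N₀, ∀ N : ℕ, N₀ ≤ N → ∀ s s', 0 ≤ s → s ≤ s' → s' ≤ T → (∫⁻ z,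
    ENNReal.ofReal (((N : ℝ)+1)⁻¹*(Φ N).collisionSum (Ioc s s') (fun col =>
    ‖col.preVel.1‖^2*‖col.preVel.2‖^2) z) ∂localGibbsLaw σ a₀ u₀ θ₀ N (Φ N)) ≤ ENNReal.ofReal (C*(σ^2*((N
    : ℝ)+1)^(1/3 : ℝ)*(s' - s)))*(⨆ r ∈ Icc s s', (∫⁻ z, ENNReal.ofReal (((N : ℝ)+1)⁻¹*∑ i, ‖((Φ N).flow r
    z i).2‖^2) ∂localGibbsLaw σ a₀ u₀ θ₀ N (Φ N)))*(⨆ r ∈ Icc s s', (∫⁻ z, ENNReal.ofReal (((N : ℝ)+1)⁻¹*∑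
    i, ‖((Φ N).flow r z i).2‖^3) ∂localGibbsLaw σ a₀ u₀ θ₀ N (Φ N)))) →
    Summit.AtomisticToContinuum.HydrodynamicLimit.Theses.OneFlightGossipEngine.EnergyCurrentTails :=
  fun hQMF hW =>
    EnergyCurrentTails_of_lossIntensityFloor4 (stub_lossIntensityFloor4_of_mixingFlux4 hQMF hW) hW

end Summit.AtomisticToContinuum.HydrodynamicLimit.Theorems.QuarticSchurLedger

end
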